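import Mathlib
import Summits.Ventures.PercRepro2.TypedUntouched

/-!
# The three-state transfer identity of the symmetrised kernel (blind cell PercRepro2, mine-2 g38,
2026-08-28; `proofs/MINE2-GADGET.md` §3, row M2-79)

`OneTypedEdge.merge_identity` says that along a one-sided merge `s → t` of ONE state the three-term
sums `KB t s s + KB s t s + KB s s t` vanish — the typed count of a single typed edge on a pinned
rest.  Here the three copies carry THREE DIFFERENT states `x, y, w` (a typed rest), and the merge
attaches `o` (resp. `b`), unattached in all three, to the same root in ONE copy at a time:

  `KBsym x⁺ y w + KBsym x y⁺ w + KBsym x y w⁺ = 0`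

(`KBsym_three_o_L / _H`, `KBsym_three_b_L / _H`; `KBsym` is `Untouched.KBsym`, the `S₃`-symmetrised
eight-term kernel on states).  This is the identity behind the universal Y-gadget rule of the
typed equality locus (an edge of type `1` from `o`'s `a₃`-side to a vertex adjacent to the roots
acts, in its one copy, as an `o`–root edge; the three placements of that copy cancel).  The
identity is FALSE for the merge of `a₃` alone and for the merge of `{o, b}` (516 and 12 failing
triples of 729 and 27, `code/merge3.py`), true for `{o}`, `{b}`, `{o, a₃}`, `{b, a₃}`,
`{o, b, a₃}`.  The two `o`-identities are also a polynomial identity in the side signs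
(`proofs/MINE2-GADGET.md` §3).

Each theorem is decided on its 4,096 `Q`-state triples (`decide +kernel`) and extended to the
states failing `Q` by `KB_eq_zero_of_q'`.  Own code; standard axioms.
-/

namespace Summit.Ventures.PercRepro2

open UnionCluster

namespace CovForm

namespace ThreeState

open OneTyped Untouched

/-! ## States with a prescribed `o`-part or `b`-part -/

/-- The state `(q′, L_o, H_o, L_b, H_b, L₃, H₃)` with `o` attached to neither root. -/
def stO0 (q Lb Hb L3 H3 : Bool) : St := (q, false, false, Lb, Hb, L3, H3)

/-- The same state with `o` attached to `a₁`. -/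
def stOL (q Lb Hb L3 H3 : Bool) : St := (q, true, false, Lb, Hb, L3, H3)

/-- The same state with `o` attached to `a₂`. -/
def stOH (q Lb Hb L3 H3 : Bool) : St := (q, false, true, Lb, Hb, L3, H3)

/-- The state with `b` attached to neither root. -/
def stB0 (q Lo Ho L3 H3 : Bool) : St := (q, Lo, Ho, false, false, L3, H3)

/-- The same state with `b` attached to `a₁`. -/
def stBL (q Lo Ho L3 H3 : Bool) : St := (q, Lo, Ho, true, false, L3, H3)

/-- The same state with `b` attached to `a₂`. -/
def stBH (q Lo Ho L3 H3 : Bool) : St := (q, Lo, Ho, false, true, L3, H3)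

/-- The symmetrised kernel vanishes as soon as one state fails `Q`. -/
theorem KBsym_eq_zero_of_q' (x y z : St) (h : x.q' = true ∨ y.q' = true ∨ z.q' = true) :
    KBsym x y z = 0 := by
  unfold KBsym
  rcases h with h | h | h
  · rw [KB_eq_zero_of_q' x y z (Or.inl h), KB_eq_zero_of_q' x z y (Or.inl h),
      KB_eq_zero_of_q' y x z (Or.inr (Or.inl h)), KB_eq_zero_of_q' y z x (Or.inr (Or.inr h)),
      KB_eq_zero_of_q' z x y (Or.inr (Or.inl h)), KB_eq_zero_of_q' z y x (Or.inr (Or.inr h))]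
    ring
  · rw [KB_eq_zero_of_q' x y z (Or.inr (Or.inl h)), KB_eq_zero_of_q' x z y (Or.inr (Or.inr h)),
      KB_eq_zero_of_q' y x z (Or.inl h), KB_eq_zero_of_q' y z x (Or.inl h),
      KB_eq_zero_of_q' z x y (Or.inr (Or.inr h)), KB_eq_zero_of_q' z y x (Or.inr (Or.inl h))]
    ring
  · rw [KB_eq_zero_of_q' x y z (Or.inr (Or.inr h)), KB_eq_zero_of_q' x z y (Or.inr (Or.inl h)),
      KB_eq_zero_of_q' y x z (Or.inr (Or.inr h)), KB_eq_zero_of_q' y z x (Or.inr (Or.inl h)),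
      KB_eq_zero_of_q' z x y (Or.inl h), KB_eq_zero_of_q' z y x (Or.inl h)]
    ring

/-! ## The `o`-transfer identities -/

/-- The `o → a₁` transfer identity on `Q`-states (4,096 cases). -/
theorem KBsym_three_o_L_Q (Lb₁ Hb₁ L3₁ H3₁ Lb₂ Hb₂ L3₂ H3₂ Lb₃ Hb₃ L3₃ H3₃ : Bool) :
    KBsym (stOL false Lb₁ Hb₁ L3₁ H3₁) (stO0 false Lb₂ Hb₂ L3₂ H3₂) (stO0 false Lb₃ Hb₃ L3₃ H3₃) +
      KBsym (stO0 false Lb₁ Hb₁ L3₁ H3₁) (stOL false Lb₂ Hb₂ L3₂ H3₂) (stO0 false Lb₃ Hb₃ L3₃ H3₃) +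
      KBsym (stO0 false Lb₁ Hb₁ L3₁ H3₁) (stO0 false Lb₂ Hb₂ L3₂ H3₂) (stOL false Lb₃ Hb₃ L3₃ H3₃) =
      0 := by
  revert Lb₁ Hb₁ L3₁ H3₁ Lb₂ Hb₂ L3₂ H3₂ Lb₃ Hb₃ L3₃ H3₃
  decide +kernel

/-- The `o → a₂` transfer identity on `Q`-states (4,096 cases). -/
theorem KBsym_three_o_H_Q (Lb₁ Hb₁ L3₁ H3₁ Lb₂ Hb₂ L3₂ H3₂ Lb₃ Hb₃ L3₃ H3₃ : Bool) :
    KBsym (stOH false Lb₁ Hb₁ L3₁ H3₁) (stO0 false Lb₂ Hb₂ L3₂ H3₂) (stO0 false Lb₃ Hb₃ L3₃ H3₃) +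
      KBsym (stO0 false Lb₁ Hb₁ L3₁ H3₁) (stOH false Lb₂ Hb₂ L3₂ H3₂) (stO0 false Lb₃ Hb₃ L3₃ H3₃) +
      KBsym (stO0 false Lb₁ Hb₁ L3₁ H3₁) (stO0 false Lb₂ Hb₂ L3₂ H3₂) (stOH false Lb₃ Hb₃ L3₃ H3₃) =
      0 := by
  revert Lb₁ Hb₁ L3₁ H3₁ Lb₂ Hb₂ L3₂ H3₂ Lb₃ Hb₃ L3₃ H3₃
  decide +kernel

/-- The `b → a₁` transfer identity on `Q`-states (4,096 cases). -/
theorem KBsym_three_b_L_Q (Lo₁ Ho₁ L3₁ H3₁ Lo₂ Ho₂ L3₂ H3₂ Lo₃ Ho₃ L3₃ H3₃ : Bool) :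
    KBsym (stBL false Lo₁ Ho₁ L3₁ H3₁) (stB0 false Lo₂ Ho₂ L3₂ H3₂) (stB0 false Lo₃ Ho₃ L3₃ H3₃) +
      KBsym (stB0 false Lo₁ Ho₁ L3₁ H3₁) (stBL false Lo₂ Ho₂ L3₂ H3₂) (stB0 false Lo₃ Ho₃ L3₃ H3₃) +
      KBsym (stB0 false Lo₁ Ho₁ L3₁ H3₁) (stB0 false Lo₂ Ho₂ L3₂ H3₂) (stBL false Lo₃ Ho₃ L3₃ H3₃) =
      0 := by
  revert Lo₁ Ho₁ L3₁ H3₁ Lo₂ Ho₂ L3₂ H3₂ Lo₃ Ho₃ L3₃ H3₃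
  decide +kernel

/-- The `b → a₂` transfer identity on `Q`-states (4,096 cases). -/
theorem KBsym_three_b_H_Q (Lo₁ Ho₁ L3₁ H3₁ Lo₂ Ho₂ L3₂ H3₂ Lo₃ Ho₃ L3₃ H3₃ : Bool) :
    KBsym (stBH false Lo₁ Ho₁ L3₁ H3₁) (stB0 false Lo₂ Ho₂ L3₂ H3₂) (stB0 false Lo₃ Ho₃ L3₃ H3₃) +
      KBsym (stB0 false Lo₁ Ho₁ L3₁ H3₁) (stBH false Lo₂ Ho₂ L3₂ H3₂) (stB0 false Lo₃ Ho₃ L3₃ H3₃) +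
      KBsym (stB0 false Lo₁ Ho₁ L3₁ H3₁) (stB0 false Lo₂ Ho₂ L3₂ H3₂) (stBH false Lo₃ Ho₃ L3₃ H3₃) =
      0 := by
  revert Lo₁ Ho₁ L3₁ H3₁ Lo₂ Ho₂ L3₂ H3₂ Lo₃ Ho₃ L3₃ H3₃
  decide +kernel

/-- **The `o → a₁` transfer identity**: for any three states in which `o` is attached to neither
root, attaching `o` to `a₁` in one copy at a time gives three symmetrised kernel values summing to
`0`. -/
theorem KBsym_three_o_L (q₁ q₂ q₃ Lb₁ Hb₁ L3₁ H3₁ Lb₂ Hb₂ L3₂ H3₂ Lb₃ Hb₃ L3₃ H3₃ : Bool) :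
    KBsym (stOL q₁ Lb₁ Hb₁ L3₁ H3₁) (stO0 q₂ Lb₂ Hb₂ L3₂ H3₂) (stO0 q₃ Lb₃ Hb₃ L3₃ H3₃) +
      KBsym (stO0 q₁ Lb₁ Hb₁ L3₁ H3₁) (stOL q₂ Lb₂ Hb₂ L3₂ H3₂) (stO0 q₃ Lb₃ Hb₃ L3₃ H3₃) +
      KBsym (stO0 q₁ Lb₁ Hb₁ L3₁ H3₁) (stO0 q₂ Lb₂ Hb₂ L3₂ H3₂) (stOL q₃ Lb₃ Hb₃ L3₃ H3₃) = 0 := by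
  cases q₁ <;> cases q₂ <;> cases q₃
  · exact KBsym_three_o_L_Q Lb₁ Hb₁ L3₁ H3₁ Lb₂ Hb₂ L3₂ H3₂ Lb₃ Hb₃ L3₃ H3₃
  all_goals
    rw [KBsym_eq_zero_of_q' _ _ _ (by simp [stO0, stOL, St.q']),
      KBsym_eq_zero_of_q' _ _ _ (by simp [stO0, stOL, St.q']),
      KBsym_eq_zero_of_q' _ _ _ (by simp [stO0, stOL, St.q'])]
    ring

/-- **The `o → a₂` transfer identity.** -/
theorem KBsym_three_o_H (q₁ q₂ q₃ Lb₁ Hb₁ L3₁ H3₁ Lb₂ Hb₂ L3₂ H3₂ Lb₃ Hb₃ L3₃ H3₃ : Bool) :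
    KBsym (stOH q₁ Lb₁ Hb₁ L3₁ H3₁) (stO0 q₂ Lb₂ Hb₂ L3₂ H3₂) (stO0 q₃ Lb₃ Hb₃ L3₃ H3₃) +
      KBsym (stO0 q₁ Lb₁ Hb₁ L3₁ H3₁) (stOH q₂ Lb₂ Hb₂ L3₂ H3₂) (stO0 q₃ Lb₃ Hb₃ L3₃ H3₃) +
      KBsym (stO0 q₁ Lb₁ Hb₁ L3₁ H3₁) (stO0 q₂ Lb₂ Hb₂ L3₂ H3₂) (stOH q₃ Lb₃ Hb₃ L3₃ H3₃) = 0 := by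
  cases q₁ <;> cases q₂ <;> cases q₃
  · exact KBsym_three_o_H_Q Lb₁ Hb₁ L3₁ H3₁ Lb₂ Hb₂ L3₂ H3₂ Lb₃ Hb₃ L3₃ H3₃
  all_goals
    rw [KBsym_eq_zero_of_q' _ _ _ (by simp [stO0, stOH, St.q']),
      KBsym_eq_zero_of_q' _ _ _ (by simp [stO0, stOH, St.q']),
      KBsym_eq_zero_of_q' _ _ _ (by simp [stO0, stOH, St.q'])]
    ring

/-- **The `b → a₁` transfer identity**: the same with `b` in place of `o`. -/
theorem KBsym_three_b_L (q₁ q₂ q₃ Lo₁ Ho₁ L3₁ H3₁ Lo₂ Ho₂ L3₂ H3₂ Lo₃ Ho₃ L3₃ H3₃ : Bool) :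
    KBsym (stBL q₁ Lo₁ Ho₁ L3₁ H3₁) (stB0 q₂ Lo₂ Ho₂ L3₂ H3₂) (stB0 q₃ Lo₃ Ho₃ L3₃ H3₃) +
      KBsym (stB0 q₁ Lo₁ Ho₁ L3₁ H3₁) (stBL q₂ Lo₂ Ho₂ L3₂ H3₂) (stB0 q₃ Lo₃ Ho₃ L3₃ H3₃) +
      KBsym (stB0 q₁ Lo₁ Ho₁ L3₁ H3₁) (stB0 q₂ Lo₂ Ho₂ L3₂ H3₂) (stBL q₃ Lo₃ Ho₃ L3₃ H3₃) = 0 := by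
  cases q₁ <;> cases q₂ <;> cases q₃
  · exact KBsym_three_b_L_Q Lo₁ Ho₁ L3₁ H3₁ Lo₂ Ho₂ L3₂ H3₂ Lo₃ Ho₃ L3₃ H3₃
  all_goals
    rw [KBsym_eq_zero_of_q' _ _ _ (by simp [stB0, stBL, St.q']),
      KBsym_eq_zero_of_q' _ _ _ (by simp [stB0, stBL, St.q']),
      KBsym_eq_zero_of_q' _ _ _ (by simp [stB0, stBL, St.q'])]
    ring

/-- **The `b → a₂` transfer identity.** -/
theorem KBsym_three_b_H (q₁ q₂ q₃ Lo₁ Ho₁ L3₁ H3₁ Lo₂ Ho₂ L3₂ H3₂ Lo₃ Ho₃ L3₃ H3₃ : Bool) :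
    KBsym (stBH q₁ Lo₁ Ho₁ L3₁ H3₁) (stB0 q₂ Lo₂ Ho₂ L3₂ H3₂) (stB0 q₃ Lo₃ Ho₃ L3₃ H3₃) +
      KBsym (stB0 q₁ Lo₁ Ho₁ L3₁ H3₁) (stBH q₂ Lo₂ Ho₂ L3₂ H3₂) (stB0 q₃ Lo₃ Ho₃ L3₃ H3₃) +
      KBsym (stB0 q₁ Lo₁ Ho₁ L3₁ H3₁) (stB0 q₂ Lo₂ Ho₂ L3₂ H3₂) (stBH q₃ Lo₃ Ho₃ L3₃ H3₃) = 0 := by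
  cases q₁ <;> cases q₂ <;> cases q₃
  · exact KBsym_three_b_H_Q Lo₁ Ho₁ L3₁ H3₁ Lo₂ Ho₂ L3₂ H3₂ Lo₃ Ho₃ L3₃ H3₃
  all_goals
    rw [KBsym_eq_zero_of_q' _ _ _ (by simp [stB0, stBH, St.q']),
      KBsym_eq_zero_of_q' _ _ _ (by simp [stB0, stBH, St.q']),
      KBsym_eq_zero_of_q' _ _ _ (by simp [stB0, stBH, St.q'])]
    ring

end ThreeState

end CovForm

end Summit.Ventures.PercRepro2
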